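import Summits.HubbardSuperconductivity.HubbardSuperconductivity.Theses.InfiniteVolumeFirst
import Summits.HubbardSuperconductivity.HubbardSuperconductivity.Theorems.InfiniteVolumeFirstTightnessExchange
import Summits.HubbardSuperconductivity.HubbardSuperconductivity.Theorems.FunctionFieldCertificateWindowInfraredBoundFreeCalibration
import Summits.HubbardSuperconductivity.HubbardSuperconductivity.Theorems.NoGoNogoThesis

/-!
# `NoNormalLimitState` (crux stmt-HubbardSuperconductivity-18533, route `InfiniteVolumeFirst`):
# the coupling is load-bearing — the crux's matrix is FALSE at `U = 0` for every doping
# (negative-side support, refuter crux-disprover seat; no proposition is defined here)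

The crux reads `∃ δ ∈ (0,½), ∀ U₀ > 0, ∃ U ∈ (0,U₀), M(δ,U)` with the matrix
`M(δ,U)`: for every admissible family (`N L = 2⌊(1-δ)L²/2⌋`, `ψ L` a normalised
`(N L, S^z = 0)`-sector ground state of `hubbardTorus 2 L 1 U` at every even `L`) every pointwise
limit `C`, along strictly increasing even sides, of the translation-averaged `d`-wave pair
correlations has a positive atom `liminf_R R⁻⁴ Σ_{x,y∈[0,R)²} C(x-y) > 0`.

* `noNormalLimitState_not_everyLimitHasAtom_of_tight_of_not_lro` — THE NEGATIVE TOOL: the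
  contrapositive of the landed support `TightnessExchange` (`infiniteVolumeFirst_tightnessExchange_proof`):
  a family normalised at even sides with tight small-momentum window tails and no torus LRO along the
  even sides has SOME pointwise limit without atom. A kill of the crux at `(δ,U)` is exactly ONE
  admissible family with these two properties.
* `noNormalLimitState_matrix_false_at_zero_coupling` — for every `δ ≥ -1`, `¬ M(δ, 0)`: every
  family of normalised free sector ground states has a FLAT pair structure factor `S_ψ(m) ≤ 450`
  (tree `WindowInfraredBound.free_pairStructureFactor_le`, every ground state of the degenerate free
  shells), hence tight windows (`≤ 113 ε² L²`, `windowInfraredBound_free_allGroundStates`) and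
  `LRO_L = S_ψ(0)/L² ≤ 450/L² → 0`; families exist (`NoGo.exists_groundStateInSector_seq`); apply
  the tool. So the left endpoint of `(0, U₀)` cannot be admitted and the repulsion must enter any
  proof of the atom at leading order (barrier `PerturbativeInvisibilityOfPairing`: atom
  `~ e^{-2/(αρU²)}`).
* `noNormalLimitState_closedWindow_false` — the strengthening with `∃ U ∈ (0,U₀)` replaced by
  `∀ U ∈ [0,U₀)` is false.
* `noNormalLimitState_hypotheses_nonvacuous` / `noNormalLimitState_false_without_convergence` —
  admissible families exist at every `(δ ≥ -1, U)`, and with the convergence clause dropped the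
  matrix is false (witness `C ≡ 0`): the limit function is constrained only through convergence.

This file does NOT refute the crux. Sources: J. Bardeen, L. N. Cooper, J. R. Schrieffer, Phys. Rev.
108 (1957) 1175, §II; C. N. Yang, Rev. Mod. Phys. 34 (1962) 694, §3 (no ODLRO for free fermions);
T. Kennedy, E. H. Lieb, B. S. Shastry, PRL 61 (1988) 2582 (structure factor, window, sum rule);
S. Friedli, Y. Velenik (2017) §3.7.2, §10.4. Folklore finite-dimensional statements.
-/

noncomputable section

-- the mandated namespace repeats `HubbardSuperconductivity` (single-problem summit, D-0017)
set_option linter.dupNamespace false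

namespace Summit.HubbardSuperconductivity.HubbardSuperconductivity.Theorems.NoNormalLimitState.Negative

open Literature.MathematicalPhysics.QuantumLattice Literature.Probability.LatticeModels Matrix Finset
  Filter
open Summit.HubbardSuperconductivity.HubbardSuperconductivity.Theorems
  (infiniteVolumeFirst_tightnessExchange_proof tightnessExchange_lroSeq_nonneg)
open Summit.HubbardSuperconductivity.HubbardSuperconductivity.Theorems.WindowInfraredBound
  (windowInfraredBound_free_allGroundStates free_pairStructureFactor_le)
open scoped ComplexConjugate ComplexOrder Topology

/-! ### The negative tool -/

/-- **Tight windows and no torus LRO force a limit without atom** (contrapositive of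
`TightnessExchange`, stmt-18535, landed). For any family `ψ` normalised at even sides whose window
tails are tight and which has no `d`-wave pair LRO along the even sides (summit format), it is false
that every pointwise limit of the translation-averaged pair correlations along strictly increasing
even sides has a positive atom. Kennedy–Lieb–Shastry, PRL 61 (1988) 2582; Friedli–Velenik (2017)
§10.4. [folklore] -/
theorem noNormalLimitState_not_everyLimitHasAtom_of_tight_of_not_lro
    (ψ : ∀ L, Fock (Orb (FermionTorus 2 L)))
    (hnorm : ∀ L, Even L → star (ψ L) ⬝ᵥ ψ L = 1)
    (htight : ∀ η : ℝ, 0 < η → ∃ ε : ℝ, 0 < ε ∧ ∃ L₀ : ℕ, ∀ (L : ℕ) [NeZero L], Even L → L₀ ≤ L →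
      (∑ m : Fin 2 → ZMod L, if m ≠ 0 ∧ momentumNormSq L m ≤ ε ^ 2 then
        pairStructureFactor dWaveFormFactor L (ψ L) m else 0) ≤ η * (L : ℝ) ^ 2)
    (hlro : ¬ HasLongRangeOrder (fun k => halfOpenBox 2 (2 * k))
      (fun k => torusPullback (pairFieldCorr dWaveFormFactor ψ) (2 * k))) :
    ¬ (∀ (Ls : ℕ → ℕ) (C : Site 2 → ℝ), StrictMono Ls → (∀ j, Even (Ls j)) →
      (∀ x : Site 2, Tendsto (fun j : ℕ => (∑ y ∈ halfOpenBox 2 (Ls j),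
        torusPullback (pairFieldCorr dWaveFormFactor ψ) (Ls j) (x + y) y) / ((Ls j : ℕ) : ℝ) ^ 2)
        atTop (𝓝 (C x))) →
      0 < liminf (fun R : ℕ => (∑ x ∈ halfOpenBox 2 R, ∑ y ∈ halfOpenBox 2 R, C (x - y)) /
        ((R : ℕ) : ℝ) ^ 4) atTop) :=
  fun h => hlro (infiniteVolumeFirst_tightnessExchange_proof ψ hnorm htight h)

/-! ### The free point: flat structure factor, tight windows, no LRO -/

/-- **No torus LRO at the free point, quantitative, every ground state.** For a family of normalised
sector ground states of the FREE torus (`U = 0`), at every side `L ≥ 3`: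
`|Λ_L|⁻² Σ_{x,y} G_L(x,y) = L⁻⁴ Re⟨ψ_L, Δ_dᴴΔ_d ψ_L⟩ = L⁻² S_{ψ_L}(0) ≤ 450 / L²`
(`free_pairStructureFactor_le` at `m = 0`). Bardeen–Cooper–Schrieffer (1957) §II; Yang (1962) §3.
[folklore] -/
theorem lroSeq_le_of_free {N : ℕ → ℕ} {ψ : ∀ L, Fock (Orb (FermionTorus 2 L))}
    (L : ℕ) (hL : 3 ≤ L) (h1 : star (ψ L) ⬝ᵥ ψ L = 1)
    (hgs : IsGroundStateInSector (hubbardTorus 2 L 1 0) (N L) 0 (ψ L)) :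
    (∑ x ∈ halfOpenBox 2 L, ∑ y ∈ halfOpenBox 2 L,
        torusPullback (pairFieldCorr dWaveFormFactor ψ) L x y) / ((halfOpenBox 2 L).card : ℝ) ^ 2 ≤
      450 / (L : ℝ) ^ 2 := by
  obtain ⟨n, rfl⟩ : ∃ n, L = n + 1 := ⟨L - 1, by omega⟩
  rw [torusLROSeq_pairFieldCorr_succ]
  have hS := free_pairStructureFactor_le (L := n + 1) hL hgs h1 0
  rw [pairStructureFactor_zero] at hS
  have hpos : (0 : ℝ) < ((n + 1 : ℕ) : ℝ) ^ 2 := by positivity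
  rw [div_le_iff₀ hpos] at hS
  rw [div_le_div_iff₀ (by positivity) hpos]
  calc (expect ((pairField dWaveFormFactor (n + 1))ᴴ * pairField dWaveFormFactor (n + 1))
          (ψ (n + 1))).re * ((n + 1 : ℕ) : ℝ) ^ 2
      ≤ 450 * ((n + 1 : ℕ) : ℝ) ^ 2 * ((n + 1 : ℕ) : ℝ) ^ 2 := by nlinarith
    _ = 450 * ((n + 1 : ℕ) : ℝ) ^ 4 := by ring

/-- **Tight windows at the free point, every ground state**, in the format of `TightnessExchange` /
`NoInfraredPileUp`: for `η > 0` take `ε = √(η/113)` and `L₀ = 3`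
(`windowInfraredBound_free_allGroundStates`: tails `≤ 113 ε² L²`). [folklore] -/
theorem tight_of_free {N : ℕ → ℕ} {ψ : ∀ L, Fock (Orb (FermionTorus 2 L))}
    (h1 : ∀ L, Even L → star (ψ L) ⬝ᵥ ψ L = 1)
    (hgs : ∀ L, Even L → IsGroundStateInSector (hubbardTorus 2 L 1 0) (N L) 0 (ψ L)) :
    ∀ η : ℝ, 0 < η → ∃ ε : ℝ, 0 < ε ∧ ∃ L₀ : ℕ, ∀ (L : ℕ) [NeZero L], Even L → L₀ ≤ L →
      (∑ m : Fin 2 → ZMod L, if m ≠ 0 ∧ momentumNormSq L m ≤ ε ^ 2 then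
        pairStructureFactor dWaveFormFactor L (ψ L) m else 0) ≤ η * (L : ℝ) ^ 2 := by
  intro η hη
  refine ⟨Real.sqrt (η / 113), Real.sqrt_pos.2 (by positivity), 3, ?_⟩
  intro L _ hLe hL
  have h := windowInfraredBound_free_allGroundStates hL (hgs L hLe) (h1 L hLe)
    (Real.sqrt_pos.2 (by positivity : 0 < η / 113))
  refine h.trans (le_of_eq ?_)
  rw [Real.sq_sqrt (by positivity : 0 ≤ η / 113)]
  ring

/-- **No torus LRO at the free point** (summit format, even sides): the LRO sequence of a family of
normalised free sector ground states tends to `0` (`0 ≤ LRO_{2k} ≤ 450/(2k)²`), so its `liminf` is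
`0`. [folklore] -/
theorem not_lro_of_free {N : ℕ → ℕ} {ψ : ∀ L, Fock (Orb (FermionTorus 2 L))}
    (h1 : ∀ L, Even L → star (ψ L) ⬝ᵥ ψ L = 1)
    (hgs : ∀ L, Even L → IsGroundStateInSector (hubbardTorus 2 L 1 0) (N L) 0 (ψ L)) :
    ¬ HasLongRangeOrder (fun k => halfOpenBox 2 (2 * k))
      (fun k => torusPullback (pairFieldCorr dWaveFormFactor ψ) (2 * k)) := by
  unfold HasLongRangeOrder
  have hlim : Tendsto (fun k : ℕ => (∑ x ∈ halfOpenBox 2 (2 * k), ∑ y ∈ halfOpenBox 2 (2 * k),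
      torusPullback (pairFieldCorr dWaveFormFactor ψ) (2 * k) x y) /
        ((halfOpenBox 2 (2 * k)).card : ℝ) ^ 2) atTop (𝓝 0) := by
    have hup : Tendsto (fun k : ℕ => (450 : ℝ) / ((2 * k : ℕ) : ℝ) ^ 2) atTop (𝓝 0) := by
      refine tendsto_const_nhds.div_atTop ?_
      refine (tendsto_pow_atTop two_ne_zero).comp ?_
      exact tendsto_natCast_atTop_atTop.comp (tendsto_id.const_mul_atTop' two_pos)
    refine tendsto_of_tendsto_of_tendsto_of_le_of_le' tendsto_const_nhds hup
      (Eventually.of_forall fun k => tightnessExchange_lroSeq_nonneg ψ _) ?_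
    filter_upwards [eventually_ge_atTop 2] with k hk
    exact lroSeq_le_of_free (2 * k) (by omega) (h1 _ (even_two_mul k)) (hgs _ (even_two_mul k))
  rw [hlim.liminf_eq]
  exact lt_irrefl 0

/-! ### The matrix of the crux fails at `U = 0` -/

/-- **`0 < U` is load-bearing at every doping: the matrix of `NoNormalLimitState` is FALSE at
`U = 0`.** For every `δ ≥ -1` (in particular every `δ ∈ (0,½)`): normalised free sector ground-state
families exist at all sides (`NoGo.exists_groundStateInSector_seq`); any such family has tight
windows (`tight_of_free`) and no torus LRO (`not_lro_of_free`); by the exchange tool some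
subsequential limit of its translation-averaged pair correlations has no atom. The statement below
is the crux's matrix with `hubbardTorus 2 L 1 U` specialised to `U = 0`, verbatim otherwise.
Bardeen–Cooper–Schrieffer (1957) §II; Yang (1962) §3. [folklore] -/
theorem noNormalLimitState_matrix_false_at_zero_coupling (δ : ℝ) (hδ : -1 ≤ δ) :
    ¬ (∀ (N : ℕ → ℕ) (ψ : ∀ L, Fock (Orb (FermionTorus 2 L))),
      (∀ L, Even L → N L = 2 * ⌊(1 - δ) * (L : ℝ) ^ 2 / 2⌋₊ ∧ star (ψ L) ⬝ᵥ ψ L = 1 ∧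
        IsGroundStateInSector (hubbardTorus 2 L 1 0) (N L) 0 (ψ L)) →
      ∀ (Ls : ℕ → ℕ) (C : Site 2 → ℝ), StrictMono Ls → (∀ j, Even (Ls j)) →
        (∀ x : Site 2, Tendsto (fun j : ℕ => (∑ y ∈ halfOpenBox 2 (Ls j),
          torusPullback (pairFieldCorr dWaveFormFactor ψ) (Ls j) (x + y) y) / ((Ls j : ℕ) : ℝ) ^ 2)
          atTop (𝓝 (C x))) →
        0 < liminf (fun R : ℕ => (∑ x ∈ halfOpenBox 2 R, ∑ y ∈ halfOpenBox 2 R, C (x - y)) /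
          ((R : ℕ) : ℝ) ^ 4) atTop) := by
  intro h
  obtain ⟨N, ψ, hadm⟩ :=
    Summit.HubbardSuperconductivity.NoGo.exists_groundStateInSector_seq 1 0 δ hδ
  have h1 : ∀ L, Even L → star (ψ L) ⬝ᵥ ψ L = 1 := fun L _ => (hadm L).2.1
  have hgs : ∀ L, Even L → IsGroundStateInSector (hubbardTorus 2 L 1 0) (N L) 0 (ψ L) :=
    fun L _ => (hadm L).2.2
  exact noNormalLimitState_not_everyLimitHasAtom_of_tight_of_not_lro ψ h1 (tight_of_free h1 hgs)
    (not_lro_of_free h1 hgs) (h N ψ fun L _ => hadm L)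

/-- **The closed-window strengthening is false.** `NoNormalLimitState` with `∃ U ∈ (0,U₀)`
replaced by `∀ U ∈ [0,U₀)` (the coupling window closed at the free point, and "some" strengthened to
"all") fails: instantiate `U = 0`. [folklore] -/
theorem noNormalLimitState_closedWindow_false :
    ¬ (∃ δ ∈ Set.Ioo (0:ℝ) (1 / 2), ∃ U₀ : ℝ, 0 < U₀ ∧ ∀ U ∈ Set.Ico (0:ℝ) U₀,
      ∀ (N : ℕ → ℕ) (ψ : ∀ L, Fock (Orb (FermionTorus 2 L))),
      (∀ L, Even L → N L = 2 * ⌊(1 - δ) * (L : ℝ) ^ 2 / 2⌋₊ ∧ star (ψ L) ⬝ᵥ ψ L = 1 ∧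
        IsGroundStateInSector (hubbardTorus 2 L 1 U) (N L) 0 (ψ L)) →
      ∀ (Ls : ℕ → ℕ) (C : Site 2 → ℝ), StrictMono Ls → (∀ j, Even (Ls j)) →
        (∀ x : Site 2, Tendsto (fun j : ℕ => (∑ y ∈ halfOpenBox 2 (Ls j),
          torusPullback (pairFieldCorr dWaveFormFactor ψ) (Ls j) (x + y) y) / ((Ls j : ℕ) : ℝ) ^ 2)
          atTop (𝓝 (C x))) →
        0 < liminf (fun R : ℕ => (∑ x ∈ halfOpenBox 2 R, ∑ y ∈ halfOpenBox 2 R, C (x - y)) /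
          ((R : ℕ) : ℝ) ^ 4) atTop) := by
  rintro ⟨δ, hδ, U₀, hU₀, h⟩
  exact noNormalLimitState_matrix_false_at_zero_coupling δ (by linarith [hδ.1]) (h 0 ⟨le_rfl, hU₀⟩)

/-! ### Non-vacuity and the convergence clause -/

/-- **The hypotheses of the crux are satisfiable at every `(δ ≥ -1, U)`**: admissible families
(normalised sector ground states at the prescribed filling, here even at ALL sides) exist by
finite-dimensional spectral theory. Lieb, PRL 62 (1989) 1201; Tasaki (2020) §2.2. [folklore] -/
theorem noNormalLimitState_hypotheses_nonvacuous (δ U : ℝ) (hδ : -1 ≤ δ) :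
    ∃ (N : ℕ → ℕ) (ψ : ∀ L, Fock (Orb (FermionTorus 2 L))),
      ∀ L, Even L → N L = 2 * ⌊(1 - δ) * (L : ℝ) ^ 2 / 2⌋₊ ∧ star (ψ L) ⬝ᵥ ψ L = 1 ∧
        IsGroundStateInSector (hubbardTorus 2 L 1 U) (N L) 0 (ψ L) := by
  obtain ⟨N, ψ, h⟩ := Summit.HubbardSuperconductivity.NoGo.exists_groundStateInSector_seq 1 U δ hδ
  exact ⟨N, ψ, fun L _ => h L⟩

/-- **Any proof must use the convergence clause** (and can use nothing else about `C`): the crux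
with the pointwise-convergence hypothesis dropped is false — admissible families exist at the
prover's `(δ, U)` and `C ≡ 0` has no atom. [folklore] -/
theorem noNormalLimitState_false_without_convergence :
    ¬ (∃ δ ∈ Set.Ioo (0:ℝ) (1 / 2), ∀ U₀ : ℝ, 0 < U₀ → ∃ U ∈ Set.Ioo (0:ℝ) U₀,
      ∀ (N : ℕ → ℕ) (ψ : ∀ L, Fock (Orb (FermionTorus 2 L))),
      (∀ L, Even L → N L = 2 * ⌊(1 - δ) * (L : ℝ) ^ 2 / 2⌋₊ ∧ star (ψ L) ⬝ᵥ ψ L = 1 ∧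
        IsGroundStateInSector (hubbardTorus 2 L 1 U) (N L) 0 (ψ L)) →
      ∀ (Ls : ℕ → ℕ) (C : Site 2 → ℝ), StrictMono Ls → (∀ j, Even (Ls j)) →
        0 < liminf (fun R : ℕ => (∑ x ∈ halfOpenBox 2 R, ∑ y ∈ halfOpenBox 2 R, C (x - y)) /
          ((R : ℕ) : ℝ) ^ 4) atTop) := by
  rintro ⟨δ, hδ, h⟩
  obtain ⟨U, -, hU⟩ := h 1 one_pos
  obtain ⟨N, ψ, hadm⟩ := noNormalLimitState_hypotheses_nonvacuous δ U (by linarith [hδ.1])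
  have h0 := hU N ψ hadm (fun j => 2 * j) (fun _ => 0)
    (fun a b hab => by dsimp only; omega) (fun j => even_two_mul j)
  simp only [Finset.sum_const_zero, zero_div, liminf_const, lt_self_iff_false] at h0

end Summit.HubbardSuperconductivity.HubbardSuperconductivity.Theorems.NoNormalLimitState.Negative

end
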